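import Summits.MatrixMultiplication.OmegaCensus.STPPCosetClashKillsN44

/-!
# ω-census (abelian STPP census): `{(2,3,4),(2,4,3)}` has no STPP realisation in any abelian group of order `44` — Kneser in the full-coset quotient (kernel)

HONEST FRAMING (pub-omega census; verbatim): lottery ticket; floor = certified bounds/negative ranges.
Census EXCLUSION (seat pub-omega-stpp-2 gen 31, 2026-08-29), family (b2).  A third composite-order mechanism after the cross-reading coset clash
(`STPPCrossReadingCosetClash.lean`): when the pinned readings make a set a FULL coset of the (unique) subgroup `K`, every Def-5.1 word through that set
sweeps a whole `K`-coset, i.e. it is a word of the QUOTIENT family in `H/K`.  Here: order `44 = 4·11`, pattern `{(2,3,4),(2,4,3)}`; readings `(A,C,B)` at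
block `0` and `(A,B,C)` at block `1` pin the outer stabilizer to order `4` and give `C₀ = c + K`, `B₁ = b + K` (`K` THE order-4 subgroup, Hall uniqueness
`eq_of_card_eq_coprime`).  Then `|A₁ + K| = 8`, `|(B₀ − A₀) + K| = 24`, `|C₁ + K| = 12` (the TPP words of blocks 1, 0, 1, the second term supplied by `K ⊆ B₁ − B₁`
resp. `K ⊆ C₀ − C₀`); Kneser (tree `exists_dvd_kneserLB_le_card_add`, all divisors of 44) gives `|(A₁ + K) + ((B₀ − A₀) + K)| ≥ 28`,
`|(C₁ + K) − (C₁ + K)| ≥ 20`, and then `|U| ≥ 44` for `U = (A₁ + K) + ((B₀ − A₀) + K) + ((C₁ + K) − (C₁ + K))`; but the Def-5.1 word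
`a₁ − a₀ + b₀ − b₁ + c₁ − c₁′` (tree reading `(−A,−C,−B)` at indices `(1,1,0)`) says `b ∉ U`.  In the quotient `H/K ≅ ℤ₁₁` this is Cauchy–Davenport twice
(`7 + 5 > 11`); python DATUM (HOME `pub-omega-stpp-2-g31/code/quot.py`): the quotient system has no solution and this one word is its unsat core.
Consequence: with `STPPCosetClashKillsN44.lean` the order-44 residual list is `{234_234, 234_324, 224_242_422}` (`224_242_422` also has an empty quotient system,
53 296-node search, not yet a kernel argument).  Nothing here is progress on `ω`.

References: M. Kneser, Math. Z. 58 (1953); H. Cohn, R. Kleinberg, B. Szegedy, C. Umans, FOCS 2005 (arXiv:math/0511460), Def. 5.1.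
-/

open Finset
open scoped Pointwise

namespace Summit.MatrixMultiplication.OmegaCensus.CubeNB

open Literature.Computability.AlgebraicComplexity
open Literature.Combinatorics.Additive
open Summit.MatrixMultiplication.OmegaCensus.STPPKneser

variable {H : Type*} [AddCommGroup H] [DecidableEq H] [Fintype H]

omit [Fintype H] in
/-- `kneserLB` is monotone in its first argument. [folklore] -/
theorem kneserLB_mono_left {s s' : ℕ} (t d : ℕ) (h : s ≤ s') : kneserLB s t d ≤ kneserLB s' t d := by
  unfold kneserLB
  have h1 : (s + d - 1) / d ≤ (s' + d - 1) / d := Nat.div_le_div_right (by omega)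
  exact Nat.mul_le_mul_right _ (by omega)

/-- **`{(2,3,4),(2,4,3)}` has no STPP realisation in any abelian group of order `44`** (full cosets of the order-4 subgroup + Kneser on the
quotient word). [cite: Kneser1953] [cite: CohnKleinbergSzegedyUmans2005, Def. 5.1] -/
theorem no_isSTPP_card44_234_243 (hH : Fintype.card H = 44) (A B C : Fin 2 → Finset H) (hS : IsSTPP A B C)
    (hA : ∀ i, #(A i) = ![2, 2] i) (hB : ∀ i, #(B i) = ![3, 4] i) (hC : ∀ i, #(C i) = ![4, 3] i) : False := by
  have hAne : ∀ i, (A i).Nonempty := fun i => card_pos.1 (by rw [hA]; fin_cases i <;> simp)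
  have hBne : ∀ i, (B i).Nonempty := fun i => card_pos.1 (by rw [hB]; fin_cases i <;> simp)
  have hCne : ∀ i, (C i).Nonempty := fun i => card_pos.1 (by rw [hC]; fin_cases i <;> simp)
  have hR : IsSTPP (fun j => -(A j)) (fun j => -(C j)) (fun j => -(B j)) := stpp_rotate (stpp_rotate (isSTPP_neg_reverse hS))
  -- the two full cosets (readings (A,C,B)@0 and (A,B,C)@1; Hall uniqueness of the order-4 subgroup)
  obtain ⟨K1, hK1, hK1q, t1, -, hs1⟩ := exists_carrier_middle_subset_coset' hR (nonempty_neg_family hAne) (nonempty_neg_family hCne)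
    (nonempty_neg_family hBne) 0 ⟨1, by decide⟩ (n := 44) (q := 4) (z := 8) (b := 4) (vol := 24) (a := 2) (L := 12) hH
    (by simp only [Finset.card_neg, hA]; decide) (by simp only [Finset.card_neg, hC]; decide) (by simp only [Finset.card_neg, hA, hB, hC]; decide)
    (by simp only [Finset.card_neg, hA, hB]; decide) (by simp only [Finset.card_neg, hB, hC]; decide) (by decide)
  have hsub1 : C 0 ⊆ (-t1) +ᵥ K1 := subset_coset_of_neg_subset hK1 hs1
  obtain ⟨K2, hK2, hK2q, t2, -, hs2⟩ := exists_carrier_middle_subset_coset' hS hAne hBne hCne 1 ⟨0, by decide⟩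
    (n := 44) (q := 4) (z := 8) (b := 4) (vol := 24) (a := 2) (L := 12) hH
    (by simp only [hA]; decide) (by simp only [hB]; decide) (by simp only [hA, hB, hC]; decide)
    (by simp only [hA, hC]; decide) (by simp only [hB, hC]; decide) (by decide)
  have hK : K1 = K2 := eq_of_card_eq_coprime hK1 hK2 (m := 11) hK1q hK2q (by rw [hH]) (by decide)
  subst hK
  set K := K1 with hKdef
  have hC0 : C 0 = (-t1) +ᵥ K := Finset.eq_of_subset_of_card_le hsub1 (by rw [Finset.card_vadd_finset, hK1q, hC]; decide)
  have hB1 : B 1 = t2 +ᵥ K := Finset.eq_of_subset_of_card_le hs2 (by rw [Finset.card_vadd_finset, hK1q, hB]; decide)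
  have memB1 : ∀ k ∈ K, t2 + k ∈ B 1 := fun k hk => by rw [hB1]; exact Finset.mem_vadd_finset.2 ⟨k, hk, rfl⟩
  have memC0 : ∀ k ∈ K, -t1 + k ∈ C 0 := fun k hk => by rw [hC0]; exact Finset.mem_vadd_finset.2 ⟨k, hk, rfl⟩
  have hKne : K.Nonempty := hK1.nonempty
  -- (i) |A₁ + K| = 8
  have hAK : #(A 1 + K) = 8 := by
    rw [← Finset.image_add_product, Finset.card_image_of_injOn, Finset.card_product, hA, hK1q]; · rfl
    rintro ⟨a, k⟩ hak ⟨a', k'⟩ hak' (h : a + k = a' + k')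
    simp only [Finset.coe_product, Set.mem_prod, Finset.mem_coe] at hak hak'
    obtain ⟨c, hc⟩ := hCne 1
    have hw : (a - a') + ((t2 + k) - (t2 + k')) + (c - c) = 0 := by
      have : a + k - (a' + k') = 0 := sub_eq_zero.2 h
      rw [← this]; abel
    obtain ⟨-, -, h1, h2, -⟩ := hS 1 1 1 a' hak'.1 a hak.1 (t2 + k') (memB1 k' hak'.2) (t2 + k) (memB1 k hak.2) c hc c hc hw
    rw [h1, add_right_inj] at h
    rw [← h1, h]
  -- (ii) |(B₀ − A₀) + K| = 24
  have hDK : #(D A B 0 + K) = 24 := by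
    rw [← Finset.image_add_product, Finset.card_image_of_injOn, Finset.card_product, card_D_AB hS hCne 0, hA, hB, hK1q]; · rfl
    rintro ⟨d, k⟩ hdk ⟨d', k'⟩ hdk' (h : d + k = d' + k')
    simp only [Finset.coe_product, Set.mem_prod, Finset.mem_coe] at hdk hdk'
    obtain ⟨a, ha, b, hb, rfl⟩ := mem_D.1 hdk.1
    obtain ⟨a', ha', b', hb', rfl⟩ := mem_D.1 hdk'.1
    have hw : (a' - a) + (b - b') + ((-t1 + k) - (-t1 + k')) = 0 := by
      have : b - a + k - (b' - a' + k') = 0 := sub_eq_zero.2 h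
      rw [← this]; abel
    obtain ⟨-, -, h1, h2, h3⟩ := hS 0 0 0 a ha a' ha' b' hb' b hb (-t1 + k') (memC0 k' hdk'.2) (-t1 + k) (memC0 k hdk.2) hw
    have hk : k' = k := by simpa using h3
    rw [h1, h2, hk]
  -- (iii) |C₁ + K| = 12
  have hCK : #(C 1 + K) = 12 := by
    rw [← Finset.image_add_product, Finset.card_image_of_injOn, Finset.card_product, hC, hK1q]; · rfl
    rintro ⟨c, k⟩ hck ⟨c', k'⟩ hck' (h : c + k = c' + k')
    simp only [Finset.coe_product, Set.mem_prod, Finset.mem_coe] at hck hck'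
    obtain ⟨a, ha⟩ := hAne 1
    have hw : (a - a) + ((t2 + k) - (t2 + k')) + (c - c') = 0 := by
      have : c + k - (c' + k') = 0 := sub_eq_zero.2 h
      rw [← this]; abel
    obtain ⟨-, -, -, h2, h3⟩ := hS 1 1 1 a ha a ha (t2 + k') (memB1 k' hck'.2) (t2 + k) (memB1 k hck.2) c' hck'.1 c hck.1 hw
    have hk : k' = k := by simpa using h2
    rw [h3, hk]
  -- (iv) Kneser three times (all divisors of 44)
  have hne1 : (A 1 + K).Nonempty := (hAne 1).add hKne
  have hne2 : (D A B 0 + K).Nonempty := (D_nonempty (hAne 0) (hBne 0)).add hKne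
  have hne3 : (C 1 + K).Nonempty := (hCne 1).add hKne
  have hne3' : (-(C 1 + K)).Nonempty := hne3.neg
  set X := (A 1 + K) + (D A B 0 + K) with hX
  set V := (C 1 + K) + (-(C 1 + K)) with hV
  have hXge : 28 ≤ #X := by
    obtain ⟨d, hd, hdvd, hk⟩ := exists_dvd_kneserLB_le_card_add (A 1 + K) (D A B 0 + K) hne1 hne2
    rw [hAK, hDK, hH] at *
    have hmem : d ∈ Nat.divisors 44 := Nat.mem_divisors.2 ⟨hdvd, by norm_num⟩
    exact le_trans ((by decide : ∀ d ∈ Nat.divisors 44, 28 ≤ kneserLB 8 24 d) d hmem) hk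
  have hVge : 20 ≤ #V := by
    obtain ⟨d, hd, hdvd, hk⟩ := exists_dvd_kneserLB_le_card_add (C 1 + K) (-(C 1 + K)) hne3 hne3'
    rw [Finset.card_neg, hCK, hH] at *
    have hmem : d ∈ Nat.divisors 44 := Nat.mem_divisors.2 ⟨hdvd, by norm_num⟩
    exact le_trans ((by decide : ∀ d ∈ Nat.divisors 44, 20 ≤ kneserLB 12 12 d) d hmem) hk
  have hUge : 44 ≤ #(X + V) := by
    obtain ⟨d, hd, hdvd, hk⟩ := exists_dvd_kneserLB_le_card_add X V (hne1.add hne2) (hne3.add hne3')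
    rw [hH] at hdvd
    have hmem : d ∈ Nat.divisors 44 := Nat.mem_divisors.2 ⟨hdvd, by norm_num⟩
    have h1 : kneserLB 28 20 d ≤ kneserLB #X #V d :=
      le_trans (kneserLB_mono_left 20 d hXge) (kneserLB_mono_right #X d hVge)
    exact le_trans ((by decide : ∀ d ∈ Nat.divisors 44, 44 ≤ kneserLB 28 20 d) d hmem) (le_trans h1 hk)
  have hU : X + V = univ := Finset.eq_univ_of_card _ (le_antisymm (Finset.card_le_univ _) (hH ▸ hUge))
  -- (v) the word a₁ − a₀ + b₀ − b₁ + c₁ − c₁′ (reading (−A,−C,−B), indices (1,1,0)) puts t2 outside X + V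
  have ht2 : t2 ∈ X + V := hU ▸ Finset.mem_univ _
  obtain ⟨x, hx, v, hv, hxv⟩ := Finset.mem_add.1 ht2
  obtain ⟨y, hy, z, hz, rfl⟩ := Finset.mem_add.1 hx
  obtain ⟨a1, ha1, k1, hk1, rfl⟩ := Finset.mem_add.1 hy
  obtain ⟨d, hd, k2, hk2, rfl⟩ := Finset.mem_add.1 hz
  obtain ⟨a0, ha0, b0, hb0, rfl⟩ := mem_D.1 hd
  obtain ⟨w, hw, w', hw', rfl⟩ := Finset.mem_add.1 hv
  obtain ⟨c1, hc1, k3, hk3, rfl⟩ := Finset.mem_add.1 hw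
  rw [Finset.mem_neg] at hw'
  obtain ⟨y', hy', hyw⟩ := hw'
  obtain ⟨c1', hc1', k4, hk4, rfl⟩ := Finset.mem_add.1 hy'
  -- the K-part collects into one element of K
  set κ := k1 + k2 + k3 - k4 with hκ
  have hκK : κ ∈ K := hK1.sub_mem (hK1.add_mem (hK1.add_mem hk1 hk2) hk3) hk4
  have hb1 : t2 + -κ ∈ B 1 := memB1 (-κ) (hK1.neg_mem hκK)
  -- the word, in the tree's orientation for the family (−A, −C, −B) at indices (1, 1, 0):
  have hword : (-a1 - -a0) + (-c1 - -c1') + (-b0 - -(t2 + -κ)) = 0 := by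
    have e : a1 + k1 + (b0 - a0 + k2) + (c1 + k3 + w') = t2 := hxv
    rw [← hyw] at e
    have : -a1 - -a0 + (-c1 - -c1') + (-b0 - -(t2 + -κ)) = -(a1 + k1 + (b0 - a0 + k2) + (c1 + k3 + -(c1' + k4))) + t2 := by
      rw [hκ]; abel
    rw [this, e]; abel
  obtain ⟨-, h10, -⟩ := hR 1 1 0 (-a0) (by simpa using ha0) (-a1) (by simpa using ha1) (-c1') (by simpa using hc1')
    (-c1) (by simpa using hc1) (-(t2 + -κ)) (by simpa using hb1) (-b0) (by simpa using hb0) hword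
  exact absurd h10 (by decide)

section Capstone

open Summit.MatrixMultiplication.OmegaCensus.KLister

/-- `234_243` is not realisable in any abelian group of order `44`. [cite: CohnKleinbergSzegedyUmans2005, Def. 5.1] -/
theorem notRealizable_card44_234_243 (hH : Fintype.card H = 44) : ¬ Realizable H ([(2, 3, 4), (2, 4, 3)] : List Shape) := by
  intro h
  obtain ⟨A, B, C, hS, hc⟩ := h.out
  exact no_isSTPP_card44_234_243 hH A B C hS (fun i => by fin_cases i <;> exact (hc _).2.2.2.1)
    (fun i => by fin_cases i <;> exact (hc _).2.2.2.2.1) (fun i => by fin_cases i <;> exact (hc _).2.2.2.2.2)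

end Capstone

end Summit.MatrixMultiplication.OmegaCensus.CubeNB

namespace Summit.MatrixMultiplication.OmegaCensus.KLister

open Literature.Computability.AlgebraicComplexity
open Summit.MatrixMultiplication.OmegaCensus.CubeNB

/-- Residual dead list at order `44` after the filter sweep, the coset clashes and the quotient kill: `234_234`, `234_324`, `224_242_422`. [folklore] -/
def deadN44q : List (List Shape) :=
  [[(2, 3, 4), (2, 3, 4)],
   [(2, 3, 4), (3, 2, 4)],
   [(2, 2, 4), (2, 4, 2), (4, 2, 2)]]

/-- **Order `44` conditional capstone, residual list of 3** (was 6; `…_of_dead_c` had 4). [cite: CohnKleinbergSzegedyUmans2005, Def. 5.1] -/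
theorem volume_le_of_card_eq_44_of_dead_q {H : Type*} [AddCommGroup H] [Fintype H] [DecidableEq H] (hH : Fintype.card H = 44)
    (hdead : ∀ D ∈ deadN44q, ¬ Realizable H D)
    {m : ℕ} (A B C : Fin m → Finset H) (hS : IsSTPP A B C) : ∑ i, #(A i) * #(B i) * #(C i) ≤ 44 := by
  refine volume_le_of_card_eq_44_of_dead_c hH ?_ A B C hS
  intro D hD
  simp only [deadN44c, List.mem_cons, List.not_mem_nil, or_false] at hD
  rcases hD with rfl | rfl | rfl | rfl
  · exact hdead _ (by simp [deadN44q])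
  · exact notRealizable_card44_234_243 hH
  · exact hdead _ (by simp [deadN44q])
  · exact hdead _ (by simp [deadN44q])

end Summit.MatrixMultiplication.OmegaCensus.KLister
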